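import Mathlib
import Summits.MatrixMultiplication.Statement
import Summits.MatrixMultiplication.MatrixMultiplication.Theorems.GraphEquationsAffineQuadric

/-!
# GraphEquations — the secant pencil of an affine system (M46; cell `decomp-mm`, lens-5 g40)

Helper kernel beneath the attacked crux `MultiplicityReduction` (stmt-MatrixMultiplication-27806) of
route `GraphEquations`, rung `K = 3`, in the language of the affine–quadric model
(`GraphEquationsAffineQuadric`: tests `⟨κ + L_A A + L_B B + M C, C − AB⟩`; after g40 the open content
of the rung is exactly `AffSystem.AffineQuadricRigidity n`, `n ≥ 3`).

**The secant pencil identity.**  Join two graph points `x = (A,B,AB)`, `x' = (A',B',A'B')` by the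
line `x_s = (1−s)x + s x'`.  Because the coefficient vector of an affine test is AFFINE in `(A,B,C)`
and the defect of the line off the graph is `C_s − A_sB_s = s(1−s)·(A'−A)(B'−B)`, every test value
along the line factors as

  `g(x_s) = s(1−s) · ⟨(1−s)·J_g(A,B) + s·J_g(A',B'), (A'−A)(B'−B)⟩`       (`AffTest.eval_secant`),

a PENCIL of the two Jacobian rows paired against the product of the differences.  Consequences for a
CORRECT system (`P := (A'−A)(B'−B) ≠ 0`):
* `Correct.exists_pencil_ne_zero` — for every `s ∉ {0,1}` some test has non-zero pencil value;
* `Correct.not_isKer_secant` — `P` is never a kernel direction at BOTH endpoints (two-kernel secant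
  lemma; compare the one-kernel secant `Correct.exists_linear_ne_zero_of_secant` of M40);
* `Correct.not_ratio_secant` — the kernel pairings `(⟨J_g(A',B'),P⟩)_g` and `(⟨J_g(A,B),P⟩)_g` are never
  proportional with a ratio `λ ∉ {0,1}`;
* `Correct.exists_add_jac_ne_zero` — the midpoint: `P ∉ ker` of the SUM of the two Jacobians;
* the reading for a counterexample to AQRₙ (`Correct.prodVec_sub_ne_of_isKer`): the locus
  `G_δ = {(A,B) : δ ∈ K(A,B)}` of a kernel direction `δ ≠ 0` contains no `δ`-secant —
  `(A'−A)(B'−B) ≠ δ` for all pairs of its points.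

Sorry-free; no stub credit claimed.
-/

set_option linter.dupNamespace false
set_option linter.unusedSectionVars false

noncomputable section

namespace Summit.MatrixMultiplication.MatrixMultiplication.Theorems.GraphEquations

open Matrix

variable {n : ℕ}

/-! ## Bilinearity of `prodVec` -/

/-- `(A + A')B = AB + A'B`. -/
theorem prodVec_add_left (A A' B : Vec n) : prodVec (A + A') B = prodVec A B + prodVec A' B := by
  funext q; simp [prodVec, prodEntry_add_left]

/-- `A(B + B') = AB + AB'`. -/
theorem prodVec_add_right (A B B' : Vec n) : prodVec A (B + B') = prodVec A B + prodVec A B' := by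
  funext q; simp [prodVec, prodEntry_add_right]

/-- `(A − A')B = AB − A'B`. -/
theorem prodVec_sub_left (A A' B : Vec n) : prodVec (A - A') B = prodVec A B - prodVec A' B := by
  have h := prodVec_add_left (A - A') A' B
  rw [sub_add_cancel] at h
  exact eq_sub_of_add_eq h.symm

/-- `A(B − B') = AB − AB'`. -/
theorem prodVec_sub_right (A B B' : Vec n) : prodVec A (B - B') = prodVec A B - prodVec A B' := by
  have h := prodVec_add_right A (B - B') B'
  rw [sub_add_cancel] at h
  exact eq_sub_of_add_eq h.symm

/-- The product of differences: `(A'−A)(B'−B) = A'B' − A'B − AB' + AB`. -/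
theorem prodVec_sub_sub (A A' B B' : Vec n) :
    prodVec (A' - A) (B' - B) = prodVec A' B' - prodVec A' B - prodVec A B' + prodVec A B := by
  rw [prodVec_sub_left, prodVec_sub_right, prodVec_sub_right]
  abel

/-! ## The secant line through two graph points -/

/-- The point `(1−s)·x + s·x'` of a block coordinate. -/
def secPt (X X' : Vec n) (s : ℂ) : Vec n := (1 - s) • X + s • X'

/-- `secPt` at `s = 0` is the first endpoint. -/
theorem secPt_zero (X X' : Vec n) : secPt X X' 0 = X := by
  simp [secPt]

/-- `secPt` at `s = 1` is the second endpoint. -/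
theorem secPt_one (X X' : Vec n) : secPt X X' 1 = X' := by
  simp [secPt]

/-- **Defect of the secant line off the graph:**
`(1−s)AB + sA'B' − A_sB_s = s(1−s)·(A'−A)(B'−B)`. -/
theorem secant_defect (A A' B B' : Vec n) (s : ℂ) :
    secPt (prodVec A B) (prodVec A' B') s - prodVec (secPt A A' s) (secPt B B' s)
      = (s * (1 - s)) • prodVec (A' - A) (B' - B) := by
  simp only [secPt, prodVec_add_left, prodVec_add_right, prodVec_smul_left, prodVec_smul_right,
    prodVec_sub_sub]
  funext q
  simp only [Pi.add_apply, Pi.sub_apply, Pi.smul_apply, smul_eq_mul]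
  ring

namespace AffTest

variable (g : AffTest n)

/-- **The coefficient vector is affine:** along the secant line it is the pencil of the two Jacobian
rows, `coef(x_s) = (1−s)·J(A,B) + s·J(A',B')`. -/
theorem coef_secant (A A' B B' : Vec n) (s : ℂ) :
    g.coef (secPt A A' s) (secPt B B' s) (secPt (prodVec A B) (prodVec A' B') s)
      = (1 - s) • g.jac A B + s • g.jac A' B' := by
  simp only [coef, jac_eq, secPt, mulVec_add, mulVec_smul]
  funext q
  simp only [Pi.add_apply, Pi.smul_apply, smul_eq_mul]
  ring

/-- **Secant pencil identity:** `g(x_s) = s(1−s)·⟨(1−s)J(A,B) + sJ(A',B'), (A'−A)(B'−B)⟩`. -/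
theorem eval_secant (A A' B B' : Vec n) (s : ℂ) :
    g.eval (secPt A A' s) (secPt B B' s) (secPt (prodVec A B) (prodVec A' B') s)
      = s * (1 - s) * (((1 - s) • g.jac A B + s • g.jac A' B') ⬝ᵥ prodVec (A' - A) (B' - B)) := by
  rw [eval, coef_secant, secant_defect, dotProduct_smul, smul_eq_mul]

/-- The pencil value at the midpoint `s = 1/2` is `⟨J(A,B) + J(A',B'), P⟩ / 2`. -/
theorem pencil_half (A A' B B' P : Vec n) :
    ((1 - (1 / 2 : ℂ)) • g.jac A B + (1 / 2 : ℂ) • g.jac A' B') ⬝ᵥ P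
      = (1 / 2 : ℂ) * ((g.jac A B + g.jac A' B') ⬝ᵥ P) := by
  rw [show (1 : ℂ) - 1 / 2 = 1 / 2 by norm_num, ← smul_add, smul_dotProduct, smul_eq_mul]

end AffTest

namespace AffSystem

variable {S : AffSystem n}

/-- **Correct ⇒ the pencil never vanishes off the endpoints.**  For `s ∉ {0,1}` and
`P = (A'−A)(B'−B) ≠ 0` some test has `⟨(1−s)J_g(A,B) + sJ_g(A',B'), P⟩ ≠ 0` — otherwise the secant
point `x_s ∉ W_n` passes every test. -/
theorem Correct.exists_pencil_ne_zero (hC : S.Correct) {A A' B B' : Vec n} {s : ℂ} (hs0 : s ≠ 0)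
    (hs1 : s ≠ 1) (hP : prodVec (A' - A) (B' - B) ≠ 0) :
    ∃ i, ((1 - s) • (S.test i).jac A B + s • (S.test i).jac A' B') ⬝ᵥ prodVec (A' - A) (B' - B)
      ≠ 0 := by
  by_contra h
  push Not at h
  have key : ∀ i, (S.test i).eval (secPt A A' s) (secPt B B' s)
      (secPt (prodVec A B) (prodVec A' B') s) = 0 := fun i => by
    rw [AffTest.eval_secant, h i, mul_zero]
  have hgraph := hC _ _ _ key
  have hdef := secant_defect A A' B B' s
  rw [hgraph, sub_self] at hdef
  have hs : s * (1 - s) ≠ 0 := mul_ne_zero hs0 (sub_ne_zero.mpr (Ne.symm hs1))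
  exact hP ((smul_eq_zero.mp hdef.symm).resolve_left hs)

/-- **Two-kernel secant lemma.**  `P = (A'−A)(B'−B) ≠ 0` is never a kernel direction at both
endpoints of the secant. -/
theorem Correct.not_isKer_secant (hC : S.Correct) {A A' B B' : Vec n}
    (hP : prodVec (A' - A) (B' - B) ≠ 0) (hK : S.IsKer A B (prodVec (A' - A) (B' - B))) :
    ¬ S.IsKer A' B' (prodVec (A' - A) (B' - B)) := fun hK' => by
  obtain ⟨i, hi⟩ := hC.exists_pencil_ne_zero (s := 2) two_ne_zero (by norm_num) hP
  exact hi (by rw [add_dotProduct, smul_dotProduct, smul_dotProduct, hK i, hK' i, smul_zero,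
    smul_zero, add_zero])

/-- The same with increments: `ΔA·ΔB ≠ 0` in `K(A,B)` is not in `K(A + ΔA, B + ΔB)`. -/
theorem Correct.not_isKer_add_of_isKer (hC : S.Correct) {A B ΔA ΔB : Vec n}
    (hP : prodVec ΔA ΔB ≠ 0) (hK : S.IsKer A B (prodVec ΔA ΔB)) :
    ¬ S.IsKer (A + ΔA) (B + ΔB) (prodVec ΔA ΔB) := by
  have h := hC.not_isKer_secant (A := A) (A' := A + ΔA) (B := B) (B' := B + ΔB)
  simp only [add_sub_cancel_left] at h
  exact h hP hK

/-- **No `δ`-secants inside `G_δ`.**  If `δ ≠ 0` is a kernel direction at `(A,B)` and at `(A',B')`,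
then `(A'−A)(B'−B) ≠ δ`: the locus `G_δ = {(A,B) : δ ∈ K(A,B)}` contains no pair of points whose
difference factorises `δ`.  (For a nowhere reduced correct system the `G_δ` cover `ℂ^{2N}`.) -/
theorem Correct.prodVec_sub_ne_of_isKer (hC : S.Correct) {A A' B B' δ : Vec n} (hδ : δ ≠ 0)
    (hK : S.IsKer A B δ) (hK' : S.IsKer A' B' δ) : prodVec (A' - A) (B' - B) ≠ δ := fun h => by
  rw [← h] at hδ hK hK'
  exact hC.not_isKer_secant hδ hK hK'

/-- **No proportional kernel pairings.**  If `⟨J_g(A',B'), P⟩ = λ·⟨J_g(A,B), P⟩` for every test with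
one ratio `λ ∉ {0,1}` (`P = (A'−A)(B'−B) ≠ 0`), the system is not correct: the pencil vanishes at
`s = 1/(1−λ)`. -/
theorem Correct.not_ratio_secant (hC : S.Correct) {A A' B B' : Vec n} {l : ℂ} (hl0 : l ≠ 0)
    (hl1 : l ≠ 1) (hP : prodVec (A' - A) (B' - B) ≠ 0) :
    ¬ ∀ i, (S.test i).jac A' B' ⬝ᵥ prodVec (A' - A) (B' - B)
      = l * ((S.test i).jac A B ⬝ᵥ prodVec (A' - A) (B' - B)) := fun h => by
  have h1l : (1 : ℂ) - l ≠ 0 := sub_ne_zero.mpr (Ne.symm hl1)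
  have hs0 : 1 / (1 - l) ≠ 0 := one_div_ne_zero h1l
  have hs1 : 1 / (1 - l) ≠ 1 := fun h' => by
    have : (1 : ℂ) - l = 1 := by
      have h'' := congrArg (fun x => x * (1 - l)) h'
      simp only [one_div, inv_mul_cancel₀ h1l, one_mul] at h''
      exact h''.symm
    exact hl0 (by linear_combination -this)
  obtain ⟨i, hi⟩ := hC.exists_pencil_ne_zero hs0 hs1 hP
  apply hi
  rw [add_dotProduct, smul_dotProduct, smul_dotProduct, h i, smul_eq_mul, smul_eq_mul]
  field_simp
  ring

/-- **Midpoint form.**  `P = (A'−A)(B'−B) ≠ 0` is not in the kernel of the SUM of the Jacobians: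
some test has `⟨J_g(A,B) + J_g(A',B'), P⟩ ≠ 0`. -/
theorem Correct.exists_add_jac_ne_zero (hC : S.Correct) {A A' B B' : Vec n}
    (hP : prodVec (A' - A) (B' - B) ≠ 0) :
    ∃ i, ((S.test i).jac A B + (S.test i).jac A' B') ⬝ᵥ prodVec (A' - A) (B' - B) ≠ 0 := by
  obtain ⟨i, hi⟩ := hC.exists_pencil_ne_zero (s := 1 / 2) (by norm_num) (by norm_num) hP
  refine ⟨i, fun h => hi ?_⟩
  rw [AffTest.pencil_half, h, mul_zero]

/-- **Reading for AQRₙ.**  A correct, nowhere reduced system carries at every `(A,B)` a kernel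
direction `δ(A,B) ≠ 0`, and whenever the SAME `δ` serves at two points their difference does not
factorise `δ`. -/
theorem NowhereReduced.secant_constraint (hC : S.Correct) (hNR : S.NowhereReduced) (A B : Vec n) :
    ∃ δ, δ ≠ 0 ∧ S.IsKer A B δ ∧
      ∀ A' B', S.IsKer A' B' δ → prodVec (A' - A) (B' - B) ≠ δ := by
  obtain ⟨δ, hK, hδ⟩ := (S.not_reducedAt_iff A B).mp (hNR A B)
  exact ⟨δ, hδ, hK, fun A' B' hK' => hC.prodVec_sub_ne_of_isKer hδ hK hK'⟩

end AffSystem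

end Summit.MatrixMultiplication.MatrixMultiplication.Theorems.GraphEquations

end
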